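import Summits.Ventures.GridStability.Lyapunov.NE39LossySplitLinesU3o200LPCertBlocks
import HarnessLib

/-!
# «NE39-LOSSY-SPLITU» — certificate file 2 of 3: the kernel re-decision of the cross-block TABLE `L12tab` against lit-6's
# formula `L₁₂ = −PB + (CA)ᵀdiag(λ) + Cᵀdiag(τ(a+b)/2)` (all 19 × 200 entries), and the Schur complement assembled from
# the tables (`SchF₂`) identified with the typed formula (`SchurQ_eq_F₂`)

Cell `gridfusion` (LADDER-GRIDFUSION G2.c lossy Lur'e tier, 39-bus rung); seat gridfusion-lit-6 (g10).  See file 3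
(`NE39LossySplitLinesLPCert.lean`).  Nothing here says a grid is stable.
[cite: Khalil2002, §7.1.2 Theorem 7.3; Pai1981, §3.6.3 (3.43)–(3.45); HornJohnson2013, Thm 7.7.7]
-/

noncomputable section

open Real Matrix
open Literature.Computation.Certificates
open Literature.MathematicalPhysics.PowerSystems
open Literature.MathematicalPhysics.PowerSystems.LyapunovFunctionFamily
open Summit.Ventures.GridStability.Models
open Summit.Ventures.GridStability.Bench.WSCC9LossySplitSlab (sector_sin_of_values sector_cos_of_values)
open Summit.Ventures.GridStability.Lyapunov.K2ALossySplitLines (sector_sin_of_values_wide)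
open Summit.Ventures.GridStability.Lyapunov.NE39LossySplitLines (e1 AQ CQ BLQ A_eq B_eq C_eq C_mul_B)

namespace Summit.Ventures.GridStability.Lyapunov.NE39LossySplitLinesU3o200LPCert

set_option maxHeartbeats 40000000 in
/-- **`L12tab` is `L₁₂`** entrywise, all 19 × 200 entries (kernel). -/
theorem L12lit_eq₂ : ∀ (i : Fin 10 ⊕ Fin 9) (k : (Fin 10 × Fin 10) ⊕ (Fin 10 × Fin 10)), L12F₂ i k =
    -(∑ l : Fin 10, PL₂ i (Sum.inl l) * BLQ (Sum.inl l) k + ∑ l : Fin 9, PL₂ i (Sum.inr l) * BLQ (Sum.inr l) k)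
      + (∑ l : Fin 10, CQ k (Sum.inl l) * AQ (Sum.inl l) i + ∑ l : Fin 9, CQ k (Sum.inr l) * AQ (Sum.inr l) i) * lamL₂ k
      + CQ k i * (tauL₂ k * (aL₂ k + bL₂ k) / 2) := by
  decide +kernel

/-- `L₁₂ = L12tab` (typed). -/
theorem LL12Q_eq_F₂ (i : Fin 10 ⊕ Fin 9) (k : (Fin 10 × Fin 10) ⊕ (Fin 10 × Fin 10)) : LL12Q₂ i k = L12F₂ i k := by
  rw [LL12Q_apply₂, L12lit_eq₂]

/-- The Schur complement ASSEMBLED from the tables (`Fin 19 × Fin 19`; this is what the kernel factorises). -/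
def SchF₂ : Matrix (Fin 19) (Fin 19) ℚ :=
  Matrix.of fun i j => -L11lit i j
    - ((∑ p : Fin 10, ∑ q : Fin 10, L12tab 0 p q i * (tauTab 0 p q)⁻¹ * L12tab 0 p q j)
      + (∑ p : Fin 10, ∑ q : Fin 10, L12tab 1 p q i * (tauTab 1 p q)⁻¹ * L12tab 1 p q j))

/-- `SchurQ₂ = SchF₂` (typed). -/
theorem SchurQ_eq_F₂ : SchurQ₂ = SchF₂.submatrix e1 e1 := by
  ext i j
  rw [SchurQ_apply₂, LL11Q_eq_F₂, Matrix.submatrix_apply, SchF₂, Matrix.of_apply]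
  simp only [LL12Q_eq_F₂]
  rfl


end Summit.Ventures.GridStability.Lyapunov.NE39LossySplitLinesU3o200LPCert

end
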